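/-
Copyright (c) 2026 the pub-hodgecm-mathlib formalisation cell (harness21).  Prover seat hodgecm-mathlib-F0P3a-p04 (g19): road «S3-ram» (LEAD F0P3a-plan (g13); junction
pen F0P3a-p01 (g17); S45 supplier `row_S45_hyperbolic`, junction sub-lemmas (J1)(J3) of HYP-PLAN v1; owner F0P3a-p06 (g15)); 2026-09-02.
-/
import Literature.NumberTheory.Automorphic.UnitaryLatticeTreeIsocelesVertexTestVectorsRamified   -- ★ p848440 (this seat): (V1′) adapted test vectors (brings ★ (V1), ★ G3⁗, ★ p03 §7–§9)
import Literature.NumberTheory.Automorphic.UnitaryLatticeTreeFixedGrandchildrenCountRamified    -- ★ `forall_v_conj_sub_one_le_iff_map_sub_one_le_scaleLattice`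
import HarnessLib

/-!
# The lattice graph of a hermitian space — THE ISOCELES REGION: REGION DIRECTIONS ARE NULL LINES, AND CONVERSELY AWAY FROM THE END VERTICES (tame-ramified place)
# (Bruhat–Tits 1972 §10; Kottwitz 1986 §3; Rogawski 1990 §4.9)

Topic `NumberTheory/Automorphic`; namespace `Literature.NumberTheory.Automorphic.UnitaryLatticeTree`.  THEOREMS ONLY (no definition, no instance, no notation, no named fact,
no `sorry`); kernel lane `--supports stmt-HodgeConjecture-24833`.  Cell `pub/hodgecm-mathlib` (D-0151), crux H413; road «S3-ram» (Literature seeding, count-neutral); junction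
(J★), ISOCELES wave, supplier `row_S45_hyperbolic` (S45 v4), the **(V2)→(V4) junction sub-lemmas (J1)(J3) of HYP-PLAN v1** (dealer split 2026-09-02T03:12Z; (V5) pen
F0P3a-p02 (g18)).  At an ADAPTED region vertex `v = u·r₀` (binders of ★ (V1′) `adaptedTestVectors_of_region`, p848440) and a keyed child `(uκ)·N₁`, `κ ∈ K₀`, with the
★ (V4) spellings (`Rogawski1990/DepthZeroKappaTransferTypeOneRamifiedJunctionTokenSlices`, p848299): REGDIR_u κ := the two ★ keyed LINE-TEST pairings of `(uκ)e₀` against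
`A e_{i₀}`, `ϖ^{s'}·A e_k` are `< 1`; `val_u κ := (ϖ^{d₀})⁻¹·⟨κe₀, (u⁻¹γu − 1)κe₀⟩`; «null» := `|val_u κ| < 1`.

* §1 `exists_integerMatrix_conj_of_region` — the 𝒪-matrix `Y₀ = ϖ^{−d₀}(u⁻¹γu − 1)` of ★ G3⁗ ∕ (V1) ∕ (V2) EXISTS at every region vertex `v = u·r₀` (★ entry bound).
* §2 **`v_val_lt_one_of_regDir`** (J1): REGDIR_u κ → null (every region direction is a null line) — in coordinates `x̄ = residue(κe₀)`: REGDIR ⟺ `x̄₁ + t x̄₂ = 0 ∧ e x̄₂ = 0`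
  (★ V1′), the value is `c(x̄₁ + t x̄₂)² + l x̄₂²` (★ V1 shape through ★ G3⁗ `exists_integer_eq_test_and_residue_eq`; `x̄` is isotropic because `e₀` is), and `e x̄₂ = 0`
  kills `l x̄₂²` (`l = 0 ↔ e = 0`).  **`regDir_of_v_val_lt_one_of_mem`** (J3): at a NON-END vertex (`ϖ^{s'−1}·A e_k ∈ v`, i.e. `l = e = 0`) null → REGDIR_u κ (`c ≠ 0`).
  USE ((V5) junction): P∕M keyed sets `¬REGDIR ∧ class` = `class`; E keyed set = null ∖ RegDir with RegDir ⊆ null; non-END ⇒ `∅`, END ⇒ `(2 + β) − 1` with ★ (V2) ∕ ★ (V3)(i).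

HONEST LABEL: HC_CM is proved only modulo the 2 remaining named inputs (hLiu418 24832, h413 24833) until rung 0 closes; nothing printed is asserted here (bookkeeping over ★
results); «S3-ram» has no books consequence.

## References
* [BruhatTits1972] F. Bruhat, J. Tits, *Groupes réductifs sur un corps local I*, Publ. Math. IHÉS 41 (1972), §10 (the star of a vertex = the residual building).
* [Kottwitz1986] R. E. Kottwitz, *Base change for unit elements of Hecke algebras*, Compositio Math. 60 (1986), §3 (fixed lattices of a torus element, residual data).
* [Rogawski1990] J. D. Rogawski, *Automorphic Representations of Unitary Groups in Three Variables*, Ann. of Math. Stud. 123 (1990), §4.9 pp. 54–56.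
-/

set_option autoImplicit false

noncomputable section

open scoped Valued WithZero Matrix MatrixGroups

namespace Literature.NumberTheory.Automorphic.UnitaryLatticeTree

open Literature.NumberTheory.Automorphic Literature.NumberTheory.Automorphic.HermitianLattice

variable {K : Type*} [Field K] [Valued K ℤᵐ⁰] {σ : K →+* K} {ϖ : K}

/-! ## §1 The integral test matrix of a region vertex -/

/-- **The 𝒪-matrix `Y₀ = ϖ^{−d₀}(u⁻¹γu − 1)` exists at every region vertex `v = u·r₀`** (`(γ−1)v ≤ ϖ^{d₀}v` iff all entries of `u⁻¹γu − 1` have valuation `≤ |ϖ|^{d₀}`,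
★ `forall_v_conj_sub_one_le_iff_map_sub_one_le_scaleLattice`). [cite: Kottwitz1986, §3] [cite: BruhatTits1972, §10] -/
theorem exists_integerMatrix_conj_of_region (hϖ : Valued.v ϖ = WithZero.exp (-1 : ℤ)) {γ : unitaryGroupOfForm σ ((StdForm.antidiagonal 3).over K)} (u : unitaryGroupOfForm σ ((StdForm.antidiagonal 3).over K)) {v : {M : Submodule 𝒪[K] (Fin 3 → K) // IsVertex σ ϖ ((StdForm.antidiagonal 3).over K) M}}
    (hvu : v = latticeGraphIso σ ϖ ((StdForm.antidiagonal 3).over K) u ⟨stdLattice K 3, 0, isSelfDualLattice_stdLattice_three_of_v hϖ⟩) {d₀ : ℕ} (hvR : v.1.map ((Matrix.toLin' (((γ : GL (Fin 3) K) : Matrix (Fin 3) (Fin 3) K) - 1)).restrictScalars 𝒪[K]) ≤ scaleLattice (ϖ ^ d₀) v.1) :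
    ∃ Y₀ : Matrix (Fin 3) (Fin 3) 𝒪[K], ∀ a b, ((Y₀ a b : 𝒪[K]) : K) = (ϖ ^ d₀)⁻¹ * (((((u⁻¹ * γ * u : unitaryGroupOfForm σ ((StdForm.antidiagonal 3).over K)) : GL (Fin 3) K) : Matrix (Fin 3) (Fin 3) K) - 1) a b) := by
  have hϖ0 : ϖ ≠ 0 := fun h0 => by rw [h0, map_zero] at hϖ; exact WithZero.coe_ne_zero hϖ.symm
  have hvϖ0 : Valued.v ϖ ≠ 0 := (Valuation.ne_zero_iff _).2 hϖ0
  have hv1 : v.1 = mapGL (u : GL (Fin 3) K) (stdLattice K 3) := by rw [hvu]; rfl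
  rw [hv1] at hvR
  have hent := (forall_v_conj_sub_one_le_iff_map_sub_one_le_scaleLattice γ u (pow_ne_zero d₀ hϖ0)).1 hvR
  have hint : ∀ a b, Valued.v ((ϖ ^ d₀)⁻¹ * (((((u⁻¹ * γ * u : unitaryGroupOfForm σ ((StdForm.antidiagonal 3).over K)) : GL (Fin 3) K) : Matrix (Fin 3) (Fin 3) K) - 1) a b)) ≤ 1 := fun a b => by
    rw [map_mul, map_inv₀, map_pow]
    calc (Valued.v ϖ ^ d₀)⁻¹ * Valued.v (((((u⁻¹ * γ * u : unitaryGroupOfForm σ ((StdForm.antidiagonal 3).over K)) : GL (Fin 3) K) : Matrix (Fin 3) (Fin 3) K) - 1) a b) ≤ (Valued.v ϖ ^ d₀)⁻¹ * Valued.v ϖ ^ d₀ :=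
          mul_le_mul' le_rfl ((hent a b).trans (le_of_eq (map_pow _ _ _)))
      _ = 1 := inv_mul_cancel₀ (pow_ne_zero _ hvϖ0)
  exact ⟨fun a b => ⟨(ϖ ^ d₀)⁻¹ * (((((u⁻¹ * γ * u : unitaryGroupOfForm σ ((StdForm.antidiagonal 3).over K)) : GL (Fin 3) K) : Matrix (Fin 3) (Fin 3) K) - 1) a b), hint a b⟩, fun a b => rfl⟩

/-! ## §2 Region directions are null lines; at non-END vertices null lines are region directions -/

/-- **(J1) EVERY REGION DIRECTION IS A NULL LINE**: at an adapted region vertex, REGDIR_u κ → `|val_u κ| < 1`. [cite: Kottwitz1986, §3] [cite: BruhatTits1972, §10] [cite: Rogawski1990, §4.9 pp. 54–56] -/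
theorem v_val_lt_one_of_regDir (hσ : ∀ x, σ (σ x) = x) (hvσ : ∀ a, Valued.v (σ a) = Valued.v a) (hσϖ : σ ϖ = -ϖ)
    (hϖ : Valued.v ϖ = WithZero.exp (-1 : ℤ)) (hres : ∀ x : K, Valued.v x ≤ 1 → Valued.v (σ x - x) < 1)
    {γ : unitaryGroupOfForm σ ((StdForm.antidiagonal 3).over K)}
    (d : Fin 3 → K) (hd : ∀ i, Valued.v (d i) = 1) (hdσ : ∀ i, σ (d i) = d i)
    (A : GL (Fin 3) K) (hdA : Matrix.diagonal d = (-(Matrix.diagonal d).det) • formCongr σ A ((StdForm.antidiagonal 3).over K))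
    (s : Fin 3 → K) (hγA : ((γ : GL (Fin 3) K) : Matrix (Fin 3) (Fin 3) K) = (A : Matrix (Fin 3) (Fin 3) K) * Matrix.diagonal s * ((A⁻¹ : GL (Fin 3) K) : Matrix (Fin 3) (Fin 3) K))
    (i₀ : Fin 3) {d₀ : ℕ} (he : ∀ i, Valued.v (s i - 1) ≤ Valued.v ϖ ^ d₀) (hiso : ∀ m, m ≠ i₀ → Valued.v (s i₀ - s m) = Valued.v ϖ ^ d₀)
    {s' : ℕ} (hs' : 1 ≤ s') (hgap : ∀ j k, j ≠ i₀ → k ≠ i₀ → j ≠ k → Valued.v (s j - s k) = Valued.v ϖ ^ (d₀ + 2 * s'))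
    {j k : Fin 3} (hj : j ≠ i₀) (hk : k ≠ i₀) (hjk : j ≠ k)
    (u : unitaryGroupOfForm σ ((StdForm.antidiagonal 3).over K)) {v : {M : Submodule 𝒪[K] (Fin 3 → K) // IsVertex σ ϖ ((StdForm.antidiagonal 3).over K) M}}
    (hvu : v = latticeGraphIso σ ϖ ((StdForm.antidiagonal 3).over K) u ⟨stdLattice K 3, 0, isSelfDualLattice_stdLattice_three_of_v hϖ⟩)
    (hv : IsSelfDualLattice σ ϖ ((StdForm.antidiagonal 3).over K) v.1)
    (hvR : v.1.map ((Matrix.toLin' (((γ : GL (Fin 3) K) : Matrix (Fin 3) (Fin 3) K) - 1)).restrictScalars 𝒪[K]) ≤ scaleLattice (ϖ ^ d₀) v.1)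
    (hlam : Valued.v (pairing σ ((StdForm.antidiagonal 3).over K) ((A : Matrix (Fin 3) (Fin 3) K) *ᵥ Pi.single i₀ 1) (((u : GL (Fin 3) K) : Matrix (Fin 3) (Fin 3) K) *ᵥ Pi.single 0 1)) < 1)
    (hmu : Valued.v (pairing σ ((StdForm.antidiagonal 3).over K) (ϖ ^ s' • ((A : Matrix (Fin 3) (Fin 3) K) *ᵥ Pi.single k 1)) (((u : GL (Fin 3) K) : Matrix (Fin 3) (Fin 3) K) *ᵥ Pi.single 0 1)) < 1)
    (Y₀ : Matrix (Fin 3) (Fin 3) 𝒪[K])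
    (hY₀ : ∀ a b, ((Y₀ a b : 𝒪[K]) : K) = (ϖ ^ d₀)⁻¹ * (((((u⁻¹ * γ * u : unitaryGroupOfForm σ ((StdForm.antidiagonal 3).over K)) : GL (Fin 3) K) : Matrix (Fin 3) (Fin 3) K) - 1) a b))
    (κ : unitaryGroupOfForm σ ((StdForm.antidiagonal 3).over K)) (hκ : κ ∈ unitaryInt σ ((StdForm.antidiagonal 3).over K))
    (hreg : (Valued.v (pairing σ ((StdForm.antidiagonal 3).over K) ((((u * κ : unitaryGroupOfForm σ ((StdForm.antidiagonal 3).over K)) : GL (Fin 3) K) : Matrix (Fin 3) (Fin 3) K) *ᵥ Pi.single 0 1) ((A : Matrix (Fin 3) (Fin 3) K) *ᵥ Pi.single i₀ 1)) < 1 ∧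
        Valued.v (pairing σ ((StdForm.antidiagonal 3).over K) ((((u * κ : unitaryGroupOfForm σ ((StdForm.antidiagonal 3).over K)) : GL (Fin 3) K) : Matrix (Fin 3) (Fin 3) K) *ᵥ Pi.single 0 1) (ϖ ^ s' • ((A : Matrix (Fin 3) (Fin 3) K) *ᵥ Pi.single k 1))) < 1)) :
    Valued.v ((ϖ ^ d₀)⁻¹ * pairing σ ((StdForm.antidiagonal 3).over K) (((κ : GL (Fin 3) K) : Matrix (Fin 3) (Fin 3) K) *ᵥ Pi.single 0 1) (((((u⁻¹ * γ * u : unitaryGroupOfForm σ ((StdForm.antidiagonal 3).over K)) : GL (Fin 3) K) : Matrix (Fin 3) (Fin 3) K) - 1) *ᵥ (((κ : GL (Fin 3) K) : Matrix (Fin 3) (Fin 3) K) *ᵥ Pi.single 0 1))) < 1 := by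
  have hϖ0 : ϖ ≠ 0 := fun h0 => by rw [h0, map_zero] at hϖ; exact WithZero.coe_ne_zero hϖ.symm
  obtain ⟨c, t, l, hc, hshape, hl0, -, -, -, ⟨e, hle, -, htok⟩⟩ :=
    adaptedTestVectors_of_region hσ hvσ hσϖ hϖ hres d hd hdσ A hdA s hγA i₀ he hiso hs' hgap hj hk hjk u hvu hv hvR hlam hmu Y₀ hY₀
  -- the keyed column `x = κe₀` (integral), `(uκ)e₀ = u x`
  have hκcol : ∀ i, Valued.v ((((κ : GL (Fin 3) K) : Matrix (Fin 3) (Fin 3) K) *ᵥ Pi.single 0 1) i) ≤ 1 := fun i => by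
    rw [Matrix.mulVec_single_one]; exact (mem_unitaryInt_iff.1 hκ).1 i 0
  set x₀ : Fin 3 → 𝒪[K] := fun i => ⟨(((κ : GL (Fin 3) K) : Matrix (Fin 3) (Fin 3) K) *ᵥ Pi.single 0 1) i, hκcol i⟩ with hx₀
  have hx₀c : (fun i => (x₀ i : K)) = ((κ : GL (Fin 3) K) : Matrix (Fin 3) (Fin 3) K) *ᵥ Pi.single 0 1 := rfl
  have hUK : (((u * κ : unitaryGroupOfForm σ ((StdForm.antidiagonal 3).over K)) : GL (Fin 3) K) : Matrix (Fin 3) (Fin 3) K) *ᵥ Pi.single 0 1 = ((u : GL (Fin 3) K) : Matrix (Fin 3) (Fin 3) K) *ᵥ (fun i => (x₀ i : K)) := by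
    rw [hx₀c, Matrix.mulVec_mulVec, Subgroup.coe_mul, Units.val_mul]
  have ht := htok x₀
  -- the value is the residual test form at `x̄`, and `x̄` is isotropic
  obtain ⟨tt, htt, httres⟩ := exists_integer_eq_test_and_residue_eq hvσ hres hϖ0 ((((u⁻¹ * γ * u : unitaryGroupOfForm σ ((StdForm.antidiagonal 3).over K)) : GL (Fin 3) K) : Matrix (Fin 3) (Fin 3) K) - 1) Y₀ hY₀ x₀
  have hval : ((ϖ ^ d₀)⁻¹ * pairing σ ((StdForm.antidiagonal 3).over K) (((κ : GL (Fin 3) K) : Matrix (Fin 3) (Fin 3) K) *ᵥ Pi.single 0 1) (((((u⁻¹ * γ * u : unitaryGroupOfForm σ ((StdForm.antidiagonal 3).over K)) : GL (Fin 3) K) : Matrix (Fin 3) (Fin 3) K) - 1) *ᵥ (((κ : GL (Fin 3) K) : Matrix (Fin 3) (Fin 3) K) *ᵥ Pi.single 0 1))) = (tt : K) := by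
    rw [htt, pairing_antidiagonal]
  have hrev0 : Fin.rev (0 : Fin 3) = 2 := rfl
  have hrev1 : Fin.rev (1 : Fin 3) = 1 := rfl
  have hrev2 : Fin.rev (2 : Fin 3) = 0 := rfl
  have hxx : pairing σ ((StdForm.antidiagonal 3).over K) (fun i => (x₀ i : K)) (fun i => (x₀ i : K)) = 0 := by
    rw [hx₀c, pairing_mulVec_mulVec_of_mem_unitary κ.2, pairing_antidiagonal, B₀_apply, Fin.sum_univ_three, hrev0, hrev1, hrev2]
    simp
  obtain ⟨p, hp, hpres⟩ := exists_integer_pairing_and_residue_eq hvσ hres x₀ x₀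
  have hp0 : p = 0 := Subtype.ext (by rw [hp, hxx]; rfl)
  rw [hp0, map_zero] at hpres
  have hxiso : 2 * IsLocalRing.residue 𝒪[K] (x₀ 0) * IsLocalRing.residue 𝒪[K] (x₀ 2) + IsLocalRing.residue 𝒪[K] (x₀ 1) ^ 2 = 0 := by linear_combination hpres.symm
  have hform := hshape (fun i => IsLocalRing.residue 𝒪[K] (x₀ i)) hxiso
  rw [← httres] at hform
  -- REGDIR in coordinates: `x̄₁ + t x̄₂ = 0`, `e x̄₂ = 0`
  rw [hUK] at hreg
  have h1 : IsLocalRing.residue 𝒪[K] (x₀ 1) + t * IsLocalRing.residue 𝒪[K] (x₀ 2) = 0 := ht.1.1 hreg.1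
  have h2 : e * IsLocalRing.residue 𝒪[K] (x₀ 2) = 0 := ht.2.1 hreg.2
  rw [hval, ← residue_eq_zero_iff_v_lt_one tt, hform, h1]
  rcases mul_eq_zero.1 h2 with he0 | hx2
  · rw [hle.2 he0]; ring
  · rw [hx2]; ring

/-- **(J3) AT A NON-END VERTEX EVERY NULL LINE IS A REGION DIRECTION**: at an adapted region vertex with `ϖ^{s'−1}·A e_k ∈ v`, `|val_u κ| < 1` → REGDIR_u κ.
[cite: Kottwitz1986, §3] [cite: BruhatTits1972, §10] [cite: Rogawski1990, §4.9 pp. 54–56] -/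
theorem regDir_of_v_val_lt_one_of_mem (hσ : ∀ x, σ (σ x) = x) (hvσ : ∀ a, Valued.v (σ a) = Valued.v a) (hσϖ : σ ϖ = -ϖ)
    (hϖ : Valued.v ϖ = WithZero.exp (-1 : ℤ)) (hres : ∀ x : K, Valued.v x ≤ 1 → Valued.v (σ x - x) < 1)
    {γ : unitaryGroupOfForm σ ((StdForm.antidiagonal 3).over K)}
    (d : Fin 3 → K) (hd : ∀ i, Valued.v (d i) = 1) (hdσ : ∀ i, σ (d i) = d i)
    (A : GL (Fin 3) K) (hdA : Matrix.diagonal d = (-(Matrix.diagonal d).det) • formCongr σ A ((StdForm.antidiagonal 3).over K))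
    (s : Fin 3 → K) (hγA : ((γ : GL (Fin 3) K) : Matrix (Fin 3) (Fin 3) K) = (A : Matrix (Fin 3) (Fin 3) K) * Matrix.diagonal s * ((A⁻¹ : GL (Fin 3) K) : Matrix (Fin 3) (Fin 3) K))
    (i₀ : Fin 3) {d₀ : ℕ} (he : ∀ i, Valued.v (s i - 1) ≤ Valued.v ϖ ^ d₀) (hiso : ∀ m, m ≠ i₀ → Valued.v (s i₀ - s m) = Valued.v ϖ ^ d₀)
    {s' : ℕ} (hs' : 1 ≤ s') (hgap : ∀ j k, j ≠ i₀ → k ≠ i₀ → j ≠ k → Valued.v (s j - s k) = Valued.v ϖ ^ (d₀ + 2 * s'))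
    {j k : Fin 3} (hj : j ≠ i₀) (hk : k ≠ i₀) (hjk : j ≠ k)
    (u : unitaryGroupOfForm σ ((StdForm.antidiagonal 3).over K)) {v : {M : Submodule 𝒪[K] (Fin 3 → K) // IsVertex σ ϖ ((StdForm.antidiagonal 3).over K) M}}
    (hvu : v = latticeGraphIso σ ϖ ((StdForm.antidiagonal 3).over K) u ⟨stdLattice K 3, 0, isSelfDualLattice_stdLattice_three_of_v hϖ⟩)
    (hv : IsSelfDualLattice σ ϖ ((StdForm.antidiagonal 3).over K) v.1)
    (hvR : v.1.map ((Matrix.toLin' (((γ : GL (Fin 3) K) : Matrix (Fin 3) (Fin 3) K) - 1)).restrictScalars 𝒪[K]) ≤ scaleLattice (ϖ ^ d₀) v.1)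
    (hlam : Valued.v (pairing σ ((StdForm.antidiagonal 3).over K) ((A : Matrix (Fin 3) (Fin 3) K) *ᵥ Pi.single i₀ 1) (((u : GL (Fin 3) K) : Matrix (Fin 3) (Fin 3) K) *ᵥ Pi.single 0 1)) < 1)
    (hmu : Valued.v (pairing σ ((StdForm.antidiagonal 3).over K) (ϖ ^ s' • ((A : Matrix (Fin 3) (Fin 3) K) *ᵥ Pi.single k 1)) (((u : GL (Fin 3) K) : Matrix (Fin 3) (Fin 3) K) *ᵥ Pi.single 0 1)) < 1)
    (Y₀ : Matrix (Fin 3) (Fin 3) 𝒪[K])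
    (hY₀ : ∀ a b, ((Y₀ a b : 𝒪[K]) : K) = (ϖ ^ d₀)⁻¹ * (((((u⁻¹ * γ * u : unitaryGroupOfForm σ ((StdForm.antidiagonal 3).over K)) : GL (Fin 3) K) : Matrix (Fin 3) (Fin 3) K) - 1) a b))
    (κ : unitaryGroupOfForm σ ((StdForm.antidiagonal 3).over K)) (hκ : κ ∈ unitaryInt σ ((StdForm.antidiagonal 3).over K))
    (hmem : ϖ ^ (s' - 1) • ((A : Matrix (Fin 3) (Fin 3) K) *ᵥ Pi.single k 1) ∈ v.1)
    (hnull : Valued.v ((ϖ ^ d₀)⁻¹ * pairing σ ((StdForm.antidiagonal 3).over K) (((κ : GL (Fin 3) K) : Matrix (Fin 3) (Fin 3) K) *ᵥ Pi.single 0 1) (((((u⁻¹ * γ * u : unitaryGroupOfForm σ ((StdForm.antidiagonal 3).over K)) : GL (Fin 3) K) : Matrix (Fin 3) (Fin 3) K) - 1) *ᵥ (((κ : GL (Fin 3) K) : Matrix (Fin 3) (Fin 3) K) *ᵥ Pi.single 0 1))) < 1) :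
    (Valued.v (pairing σ ((StdForm.antidiagonal 3).over K) ((((u * κ : unitaryGroupOfForm σ ((StdForm.antidiagonal 3).over K)) : GL (Fin 3) K) : Matrix (Fin 3) (Fin 3) K) *ᵥ Pi.single 0 1) ((A : Matrix (Fin 3) (Fin 3) K) *ᵥ Pi.single i₀ 1)) < 1 ∧
        Valued.v (pairing σ ((StdForm.antidiagonal 3).over K) ((((u * κ : unitaryGroupOfForm σ ((StdForm.antidiagonal 3).over K)) : GL (Fin 3) K) : Matrix (Fin 3) (Fin 3) K) *ᵥ Pi.single 0 1) (ϖ ^ s' • ((A : Matrix (Fin 3) (Fin 3) K) *ᵥ Pi.single k 1))) < 1) := by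
  have hϖ0 : ϖ ≠ 0 := fun h0 => by rw [h0, map_zero] at hϖ; exact WithZero.coe_ne_zero hϖ.symm
  obtain ⟨c, t, l, hc, hshape, hl0, -, -, -, ⟨e, hle, -, htok⟩⟩ :=
    adaptedTestVectors_of_region hσ hvσ hσϖ hϖ hres d hd hdσ A hdA s hγA i₀ he hiso hs' hgap hj hk hjk u hvu hv hvR hlam hmu Y₀ hY₀
  -- the keyed column `x = κe₀` (integral), `(uκ)e₀ = u x`
  have hκcol : ∀ i, Valued.v ((((κ : GL (Fin 3) K) : Matrix (Fin 3) (Fin 3) K) *ᵥ Pi.single 0 1) i) ≤ 1 := fun i => by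
    rw [Matrix.mulVec_single_one]; exact (mem_unitaryInt_iff.1 hκ).1 i 0
  set x₀ : Fin 3 → 𝒪[K] := fun i => ⟨(((κ : GL (Fin 3) K) : Matrix (Fin 3) (Fin 3) K) *ᵥ Pi.single 0 1) i, hκcol i⟩ with hx₀
  have hx₀c : (fun i => (x₀ i : K)) = ((κ : GL (Fin 3) K) : Matrix (Fin 3) (Fin 3) K) *ᵥ Pi.single 0 1 := rfl
  have hUK : (((u * κ : unitaryGroupOfForm σ ((StdForm.antidiagonal 3).over K)) : GL (Fin 3) K) : Matrix (Fin 3) (Fin 3) K) *ᵥ Pi.single 0 1 = ((u : GL (Fin 3) K) : Matrix (Fin 3) (Fin 3) K) *ᵥ (fun i => (x₀ i : K)) := by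
    rw [hx₀c, Matrix.mulVec_mulVec, Subgroup.coe_mul, Units.val_mul]
  have ht := htok x₀
  -- the value is the residual test form at `x̄`, and `x̄` is isotropic
  obtain ⟨tt, htt, httres⟩ := exists_integer_eq_test_and_residue_eq hvσ hres hϖ0 ((((u⁻¹ * γ * u : unitaryGroupOfForm σ ((StdForm.antidiagonal 3).over K)) : GL (Fin 3) K) : Matrix (Fin 3) (Fin 3) K) - 1) Y₀ hY₀ x₀
  have hval : ((ϖ ^ d₀)⁻¹ * pairing σ ((StdForm.antidiagonal 3).over K) (((κ : GL (Fin 3) K) : Matrix (Fin 3) (Fin 3) K) *ᵥ Pi.single 0 1) (((((u⁻¹ * γ * u : unitaryGroupOfForm σ ((StdForm.antidiagonal 3).over K)) : GL (Fin 3) K) : Matrix (Fin 3) (Fin 3) K) - 1) *ᵥ (((κ : GL (Fin 3) K) : Matrix (Fin 3) (Fin 3) K) *ᵥ Pi.single 0 1))) = (tt : K) := by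
    rw [htt, pairing_antidiagonal]
  have hrev0 : Fin.rev (0 : Fin 3) = 2 := rfl
  have hrev1 : Fin.rev (1 : Fin 3) = 1 := rfl
  have hrev2 : Fin.rev (2 : Fin 3) = 0 := rfl
  have hxx : pairing σ ((StdForm.antidiagonal 3).over K) (fun i => (x₀ i : K)) (fun i => (x₀ i : K)) = 0 := by
    rw [hx₀c, pairing_mulVec_mulVec_of_mem_unitary κ.2, pairing_antidiagonal, B₀_apply, Fin.sum_univ_three, hrev0, hrev1, hrev2]
    simp
  obtain ⟨p, hp, hpres⟩ := exists_integer_pairing_and_residue_eq hvσ hres x₀ x₀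
  have hp0 : p = 0 := Subtype.ext (by rw [hp, hxx]; rfl)
  rw [hp0, map_zero] at hpres
  have hxiso : 2 * IsLocalRing.residue 𝒪[K] (x₀ 0) * IsLocalRing.residue 𝒪[K] (x₀ 2) + IsLocalRing.residue 𝒪[K] (x₀ 1) ^ 2 = 0 := by linear_combination hpres.symm
  have hform := hshape (fun i => IsLocalRing.residue 𝒪[K] (x₀ i)) hxiso
  rw [← httres] at hform
  -- non-END: `l = 0`, `e = 0`; null ⇒ `x̄₁ + t x̄₂ = 0`
  have hl : l = 0 := hl0.2 hmem
  have he0 : e = 0 := hle.1 hl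
  rw [hval, ← residue_eq_zero_iff_v_lt_one tt, hform, hl, zero_mul, add_zero] at hnull
  have h1 : IsLocalRing.residue 𝒪[K] (x₀ 1) + t * IsLocalRing.residue 𝒪[K] (x₀ 2) = 0 :=
    (pow_eq_zero_iff (n := 2) (by norm_num)).1 ((mul_eq_zero.1 hnull).resolve_left hc)
  rw [hUK]
  exact ⟨ht.1.2 h1, ht.2.2 (by rw [he0, zero_mul])⟩

end Literature.NumberTheory.Automorphic.UnitaryLatticeTree

end
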